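import Literature.MathematicalPhysics.QuantumFieldTheory.Balaban1983to89.Node00.OpsYRead342
import Literature.MathematicalPhysics.QuantumFieldTheory.Balaban1983to89.B9SectBGpLettersY
import Literature.MathematicalPhysics.QuantumFieldTheory.Balaban1983to89.B9RWSumsCompleteGeo9YNbr
import Literature.MathematicalPhysics.QuantumFieldTheory.Balaban1983to89.B9GeoNbrCountKLevelV1

/-!
# `Balaban1983to89.Node00.OpsYRead342Cross` — THE TWO CROSS ORIENTATION COMBOS OF (3.42) AT ONE AND THE SAME CONFIGURATION:
# `η‖(∇*_{V,μ}O(V)(f ⊗ E))(z)‖` (backward difference on the LEFT of the letter) and `η‖(O(V)∇_{V,μ}(f ⊗ E))(z)‖` (forward difference on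
# the RIGHT), bounded by `C·B₀·ℓ(y)·e^{−δd(y,y′)}·|f|` from the (3.42) block `EBlock (Node00.kernelFamilyS i B cfg O par) B₀ δ U₁` of NODE 00's
# reading (which carries print's two orientations only: `∇_U G′` forward-LEFT, `G′∇*_U` backward-RIGHT), with EXPLICIT constants
# `C_L = L·e^{2(d+1)|δ|}` and `C_R = m_N·M₂(Σ_j‖b_j‖)·e^{2(d+1)|δ|}`; plus the two block majorants ([4] (2.51)) of the conjugated cross letters.

T. Bałaban, *Propagators for lattice gauge theories in a background field*, Commun. Math. Phys. **99** (1985) 389–434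
[`Balaban1985BackgroundPropagators`, "B9"]; [4] = T. Bałaban, *Propagators and renormalization transformations for lattice gauge
theories. II*, Commun. Math. Phys. **96** (1984) 223–250 [`Balaban1984PropagatorsII`].

statement-level skeleton of published theorems with citation tags; proofs where landed; nothing here is a claim about the
Yang–Mills mass gap

THE PRINTED LOCI.  Thm 3.1 (3.42) p. 397: *"|(G′(U)λ)(x)|, |(∇_U G′(U)λ)(x)|, |(G′(U)∇*_U λ)(x)|, |(Δ_U G′(U)λ)(x)| ≤ B₀[(Lʲη)², Lʲη, Lʲη, 1]e^{−δ₀d(y,y′)}|λ|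
for x ∈ Δ(y), y ∈ Λ_j, supp λ ⊂ Δ(y′)"* — exactly four entries, `∇_U` on the LEFT of `G′(U)` and `∇*_U` on the RIGHT only (lit-balaban-r06, QUOTATION
CHECK #9); (3.3) p. 390 `(∇_{U,μ}f)(x) = η⁻¹[R(U(x,x+e_μ))f(x+e_μ) − f(x)]`; (3.8) p. 392 with (3.5) p. 391: `(∇*_{U,μ}g)(x) = η⁻¹[R(U(x−e_μ,x))⁻¹g(x−e_μ) − g(x)]`,
i.e. `∇*_μ = −R(U⁻¹)τ_{−μ}∇_μ` (`B9Eq371Composition.covDstar_eq_neg_R_covD`) and `∇_μ = −∇*_μ∘T_μ` with the covariant forward transport-shift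
`(T_μΦ)(x) = R(U(x,x+e_μ))Φ(x+e_μ)`; [4] (2.2) p. 224 + Lemma 2.1 (2.60)–(2.61) p. 234 (neighbouring blocks differ by at most one level; the number of
blocks within a fixed distance is bounded above an `M`-threshold); [4] (2.51) p. 232 (block majorants `|(Tλ)(x)| ≦ K(y,y′)|λ|`).

WHY THIS FILE (cell `pub-ymgap`, N06 row 13; seat `pub-ymgap-node00-def-Y` gen 14, the OpsY-instance owner; dag-n06-c g7's request, fleet bus
l.23401 ∕ INTENT-26 l.23507).  dag-n06-c instantiates the Sect.-B frames at the AUGMENTED coded reading `B9SectBGpReadingsY.kernelFamilySC` (entries 1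
and 2 = `max` over BOTH covariant differences) and transfers the Sect.-B step back to the record's family `Node00.kernelFamilyS` by
`B9SectBStepFamilyTransfer.sectBStepPrinted_of_family`, whose input domination `hin` needs, at every regular `U`, the (3.42) block of the record's
reading to give the block of the augmented one «of course with different constants» (p. 403) — i.e. the two CROSS sups `‖∇*_{U,μ}G′(U)λ‖` and
`‖G′(U)∇_{U,μ}λ‖` bounded like print's entries, the constant being allowed to depend on `(δ, L, d)` and on an `M`-threshold.  This file supplies
exactly those two bounds at ONE configuration `V = cfg U₁`, in NODE 00's own currency (`cdS ∕ cdsS ∕ liftY ∕ supBlkS`-level, the shape of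
`Node00.OpsYRead342` §4), and their (2.51) majorant forms (the shape of `Node00.OpsYRead342` §4 ★★):
* §1 TRANSPORT IDENTITIES at def-Y's operators: `cdsS_apply_eq_neg_R_cdS` (∇*_μ = −R(U(z−e_μ))⁻¹τ_{−μ}∇_μ, pointwise), `norm_cdsS_le_norm_cdS_symm_shift`
  (under unit norms of the bond variables the backward difference at `z` is bounded by the forward one at `z − e_μ`), ★ `cdS_eq_neg_cdsS_transport`
  (`∇_{V,μ}Φ = −∇*_{V,μ}(T_μΦ)`), `transport_liftY_eq_sum` (`T_μ(f ⊗ E) = Σ_j g_j ⊗ b_j`, `g_j(w) = f(w+e_μ)·repr_j(R(U_μ(w))E)` — the transport-shift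
  of an amplitude is a sum of amplitudes along the basis).
* §2 GEOMETRY of the one-bond shift: `len_blkC_symm_shift_le` (`ℓ(Δ(z−e_μ)) ≤ L·ℓ(Δ(z))` once `2(d+1) < M`, from dag-n06-c's stencil `stencilB_blkC`
  and the level gap `B9RWSumsCompleteGeo9YNbr.len_le_of_dist_lt_M_geo9K`); moving one block by `≤ r` costs `e^{δr}` ((2.54) + the triangle
  inequality `B9GeoLemma21KLevelV1.geo9K_dist_triangle`).
* §3 ★★ LEFT-BACKWARD CROSS ENTRY: `eta_mul_norm_cdsS_O_le_of_eBlock` — `η‖(∇*_{V,μ}O(V)(f ⊗ E))(z)‖ ≤ L·e^{2(d+1)|δ|}·B₀ℓ(y)e^{−δd(y,y′)}|f|` for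
  `‖E‖ ≤ 1`, `supp f ⊂ Δ(βy′)`, `z ∈ Δ(βy)` (print's entry 1 read at the NEIGHBOUR block of `z − e_μ`).
* §4 ★★ RIGHT-FORWARD CROSS ENTRY: `eta_mul_norm_O_cdS_le_of_eBlock` — `η‖(O(V)∇_{V,μ}(f ⊗ E))(z)‖ ≤ m_N·M₂(Σ_j‖b_j‖)·e^{2(d+1)|δ|}·B₀ℓ(y)e^{−δd(y,y′)}|f|`
  (print's entry 2 applied to the BLOCK PIECES `g_j·1_{Δ(βa)}`, `a` in the radius-`2(d+1)` neighbourhood `B9RWSumsReadsNbr.nbr` of `y′` (dag-n06-c's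
  stencil `stencilF_blkC`), of the transported amplitude; `m_N` bounds the neighbourhood count — a hypothesis of the «`Mi ≤ M`» kind, discharged
  uniformly by `B9GeoNbrCountKLevelV1.exists_card_nbr_geo9K_le`).
* §5 ★ THE TWO CROSS LETTER COMPOSITES unfolded (`neg_gradB_mul_apply`, `mul_gradF_apply`) and their (2.51) BLOCK MAJORANTS through coordinates
  (`Node00.OpsYRead342.hasMajorant_conj_of_ball_bound`): `hasMajorant_gradB_mul_G_of_eBlock` (backward letter `k = inr μ` on the LEFT) and
  `hasMajorant_G_mul_gradF_of_eBlock` (forward letter `k = inl μ` on the RIGHT), constants `C_L ∕ C_R` times `M₂(Σ_j‖b_j‖)·B₀`, profile `ℓ(a)`, SAME rate `δ`.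
Hypotheses beyond `Node00.OpsYRead342` §4's (the rate `δ` of EITHER sign, as there): unit norms `‖U_μ(z)‖ ≤ 1`, `‖U_μ(z)⁻¹‖ ≤ 1` of the box-chart bond variables `UboxY i (cfg U₁)` (at the
record: `G`-valued configurations, `G ≤ U(N)`); the threshold `2(d+1) < M` (`M = L·M_h ≥ 24`, so automatic for `d + 1 ≤ 11`); for §4∕§5-right the count `m_N`.
CORNER-FREE MEMBERS ONLY: as in `Node00.OpsYRead342`, every statement carries a SECTION `ιB` of the carrier-block map `β` (`hι`), which exists iff the
member has no inner corner (`B9BetaRangeKLevelV1.surjective_beta_iff`).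

HONEST SCOPE.  Finite-dimensional linear algebra, the two transport identities and sup bookkeeping over def-Y's definitions and r06's letters; every
bound is an identity-level consequence of the cited shapes with the constants displayed; nothing of [B9] Thm 3.1 or [4] Lemma 2.1 is asserted (the
level gap and the neighbourhood count are CITED from the tree); COUNT-NEUTRAL; N06 NOT discharged; `kernelFamilySC ∕ KSC ∕ hin ∕ hout` are dag-n06-c's
and not touched; one finite 𝕋⁴ programme at fixed ε — nothing continuum, nothing about the mass gap.  Cell `pub-ymgap` (HUMAN RULING D-0062), Track A
node N06 [B9], seat `pub-ymgap-node00-def-Y` (g14), 2026-08-27.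

RELATED IN THE TREE, NOT DUPLICATED: `Node00.OpsYRead342` (the four print-orientation entries and majorants, the (2.51) core), `B9SectBGpReadingsY` (n06-c's
augmented family and its dictionaries), `B9SectBGpLettersY` (`blkC`, the stencils), `B9Eq371Composition.covDstar_eq_neg_R_covD`, `B9Eq310Hermitian.norm_R_le`,
`B9RWSumsCompleteGeo9YNbr.len_le_of_dist_lt_M_geo9K`, `B9GeoNbrCountKLevelV1` ∕ `B9RWSumsReadsNbr.nbr` — USED BY NAME; no existing module modified.
-/

namespace Literature.MathematicalPhysics.QuantumFieldTheory.Balaban1983to89.Node00.OpsYRead342Cross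

open B6Geom246MultiLevelBox (bset blkOf)
open B6Ineq2142KLevelV1 (β)
open B6KLevelCensusIndexV1 (KIdx kGeo)
open B6RandomWalk (HasMajorant hasMajorant_mono)
open B9Thm34Ext (toB6)
open B9FromB6 (EBlock)
open B9GeoNormsKLevelV1 (geo9K)
open B9GeoLemma21KLevelV1 (geo9K_dist_comm geo9K_dist_triangle geo9K_dist_nonneg')
open B9Eq39Adjoint (R R_smul R_inv_R covD covDstar covD_smul covDstar_smul)
open B9Eq310Hermitian (norm_R_le)
open B9Eq371Composition (covDstar_eq_neg_R_covD)
open B9Eq352DivFormLetters (conj gradLetterF gradLetterB gradLetterF_apply gradLetterB_apply)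
open B9Eq352GradLetters (diffLetter diffLetter_inl diffLetter_inr)
open B9Ineq349SiteComposite (cdsSL cdsSL_apply etaS_pos norm_le_norm_mul_of_ball)
open B9SectBGpLettersY (blkC stencilF_blkC stencilB_blkC)
open B9RWSumsReadsNbr (nbr mem_nbr)
open B9RWSumsCompleteGeo9YNbr (len_le_of_dist_lt_M_geo9K)
open OpsYRead342 (hasMajorant_conj_of_ball_bound eta_mul_norm_cdS_le_of_eBlock eta_mul_norm_cdsS_le_of_eBlock abs_le_supNorm_inl
  geo9K_len_congr geo9K_dist_congr liftY_smul_right)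

variable {d ℓ : ℕ} {hd : 1 ≤ d + 1} {hL : Odd (ℓ + 1) ∧ 1 < ℓ + 1} {b₀ b₁ : ℝ}
variable {𝔸 : Type} [NormedRing 𝔸] [NormedAlgebra ℂ 𝔸] [CompleteSpace 𝔸]
variable {ι : Type} [Fintype ι]
variable (i : KIdx d ℓ hd hL b₀ b₁) (b : Module.Basis ι ℝ 𝔸)

/-! ## §1 Transport identities at def-Y's covariant differences -/

section Transport

variable (V : CfgY 𝔸 i)

omit [Fintype ι] in
/-- `∇*_{V,μ} = −R(U_μ(z−e_μ))⁻¹ τ_{−μ} ∇_{V,μ}` at def-Y's operators, pointwise: `(∇*Ψ)(z) = −R(U_μ(z−e_μ))⁻¹((∇Ψ)(z−e_μ))`.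
[cite: Balaban1985BackgroundPropagators, (3.8) p.392, (3.5) p.391] -/
theorem cdsS_apply_eq_neg_R_cdS (μ : Fin (d + 1)) (Ψ : SiteY i → 𝔸) (z : SiteY i) :
    cdsS i V μ Ψ z = -R (UboxY i V μ ((shiftY i μ).symm z))⁻¹ (cdS i V μ Ψ ((shiftY i μ).symm z)) :=
  covDstar_eq_neg_R_covD (shiftY i) (UboxY i V) μ Ψ z

omit [Fintype ι] in
/-- under unit norms of the bond variables (`‖U_μ(w)‖ ≤ 1`, `‖U_μ(w)⁻¹‖ ≤ 1`) the backward difference at `z` is bounded by the forward one at `z − e_μ`: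
`‖(∇*_{V,μ}Ψ)(z)‖ ≤ ‖(∇_{V,μ}Ψ)(z−e_μ)‖`. [cite: Balaban1985BackgroundPropagators, (3.8) p.392, (3.5) p.391 (R(U) norm-preserving at unitary U)] -/
theorem norm_cdsS_le_norm_cdS_symm_shift
    (hU1 : ∀ (μ : Fin (d + 1)) (w : SiteY i), ‖((UboxY i V μ w : 𝔸ˣ) : 𝔸)‖ ≤ 1 ∧ ‖(((UboxY i V μ w)⁻¹ : 𝔸ˣ) : 𝔸)‖ ≤ 1)
    (μ : Fin (d + 1)) (Ψ : SiteY i → 𝔸) (z : SiteY i) :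
    ‖cdsS i V μ Ψ z‖ ≤ ‖cdS i V μ Ψ ((shiftY i μ).symm z)‖ := by
  rw [cdsS_apply_eq_neg_R_cdS, norm_neg]
  refine norm_R_le (hU1 μ _).2 ?_ _
  rw [inv_inv]
  exact (hU1 μ _).1

omit [Fintype ι] in
/-- ★ **`∇_{V,μ} = −∇*_{V,μ}∘T_μ`** with the covariant forward TRANSPORT-SHIFT `(T_μΦ)(w) = R(U_μ(w))Φ(w+e_μ)`:
`R(U_μ(z−e_μ))⁻¹R(U_μ(z−e_μ))Φ(z) − R(U_μ(z))Φ(z+e_μ) = −(∇_{V,μ}Φ)(z)`. [cite: Balaban1985BackgroundPropagators, (3.3) p.390, (3.8) p.392, (3.5) p.391] -/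
theorem cdS_eq_neg_cdsS_transport (μ : Fin (d + 1)) (Φ : SiteY i → 𝔸) :
    cdS i V μ Φ = -cdsS i V μ (fun w => R (UboxY i V μ w) (Φ (shiftY i μ w))) := by
  funext z
  rw [Pi.neg_apply]
  show covD (shiftY i) (UboxY i V) μ Φ z = -covDstar (shiftY i) (UboxY i V) μ (fun w => R (UboxY i V μ w) (Φ (shiftY i μ w))) z
  simp only [covD, covDstar, R_inv_R, Equiv.apply_symm_apply, neg_sub]

omit [CompleteSpace 𝔸] in
/-- lifts commute with finite sums of the scalar functions. [cite: Balaban1985BackgroundPropagators, (3.39) p.397, bookkeeping] -/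
private theorem liftY_finset_sum {X S : Type} (s : Finset S) (h : S → X → ℝ) (E : 𝔸) :
    liftY (∑ a ∈ s, h a) E = ∑ a ∈ s, liftY (h a) E := by
  classical
  induction s using Finset.induction_on with
  | empty => funext x; simp [liftY_apply]
  | insert a s ha ih => rw [Finset.sum_insert ha, Finset.sum_insert ha, liftY_add, ih]

/-- ★ the transport-shift of an AMPLITUDE is a sum of amplitudes along the basis: `T_μ(f ⊗ E) = Σ_j g_j ⊗ b_j`,
`g_j(w) = f(w+e_μ)·repr_j(R(U_μ(w))E)`. [cite: Balaban1985BackgroundPropagators, (3.39) p.397 + (3.3) p.390, bookkeeping] -/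
theorem transport_liftY_eq_sum (μ : Fin (d + 1)) (f : SiteY i → ℝ) (E : 𝔸) :
    (fun w => R (UboxY i V μ w) (liftY f E (shiftY i μ w)))
      = ∑ j, liftY (fun w => f (shiftY i μ w) * b.repr (R (UboxY i V μ w) E) j) (b j) := by
  funext w
  rw [Finset.sum_apply, liftY_apply, R_smul]
  conv_lhs => rw [← b.sum_repr (R (UboxY i V μ w) E)]
  rw [Finset.smul_sum]
  refine Finset.sum_congr rfl fun j _ => ?_
  simp only [liftY_apply, Complex.ofReal_mul, mul_smul, Complex.coe_smul]

end Transport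

/-! ## §2 Geometry of the one-bond shift: lengths within a factor `L`, distances within `2(d+1)` -/

section Geometry

variable (ιB : BlkY i → IBondY i)

omit [NormedRing 𝔸] [NormedAlgebra ℂ 𝔸] [CompleteSpace 𝔸] [Fintype ι] in
/-- ★ the labelled block of `z − e_μ` has length at most `L` times that of the block of `z`, once `2(d+1) < M` (the blocks are within `2(d+1)`, hence
neighbours differing by at most one level). [cite: Balaban1984PropagatorsII, (2.2) p.224 + Lemma 2.1 (2.60) p.234; Balaban1985BackgroundPropagators, p.397 (Δ̃(y))] -/
theorem len_blkC_symm_shift_le (hι : ∀ s, β i.hN i.D i.hk (ιB s) = s) (hdM : 2 * ((d : ℝ) + 1) < (geo9K i).M)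
    (μ : Fin (d + 1)) (z : SiteY i) :
    (geo9K i).len (blkC i ιB ((shiftY i μ).symm z)) ≤ ((ℓ + 1 : ℕ) : ℝ) * (geo9K i).len (blkC i ιB z) :=
  len_le_of_dist_lt_M_geo9K i (lt_of_le_of_lt (by rw [geo9K_dist_comm]; exact stencilB_blkC i ιB hι μ z) hdM)

omit [NormedRing 𝔸] [NormedAlgebra ℂ 𝔸] [CompleteSpace 𝔸] [Fintype ι] in
/-- moving a block by at most `r` costs a factor `e^{|δ|r}` in the decay, for a rate of EITHER sign: `|u − v| ≤ r ⇒ e^{−δv} ≤ e^{|δ|r}·e^{−δu}` — the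
arithmetic of `B5FromB4.exp_shift` (stated there one-sided with `δ ≥ 0`; not imported, to keep this module's closure). [cite: Balaban1984PropagatorsII, (2.54) p.233, bookkeeping] -/
private theorem exp_neg_le_exp_mul_exp_neg {δ r u v : ℝ} (h₁ : u ≤ r + v) (h₂ : v ≤ r + u) :
    Real.exp (-(δ * v)) ≤ Real.exp (|δ| * r) * Real.exp (-(δ * u)) := by
  rw [← Real.exp_add]
  apply Real.exp_le_exp.2
  have h3 : |u - v| ≤ r := abs_sub_le_iff.2 ⟨by linarith, by linarith⟩
  have h4 : δ * (u - v) ≤ |δ| * r :=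
    (le_abs_self _).trans (by rw [abs_mul]; exact mul_le_mul_of_nonneg_left h3 (abs_nonneg δ))
  rw [mul_sub] at h4
  linarith

end Geometry

/-! ## §3 ★★ The LEFT-BACKWARD cross entry: `η‖(∇*_{V,μ}O(V)(f ⊗ E))(z)‖ ≤ L·e^{2(d+1)|δ|}·B₀ℓ(y)e^{−δd(y,y′)}|f|` -/

section Cross

variable {B : B9.Backgrounds} (cfg : B.Cfg → CfgY 𝔸 i) (O : SiteOpY 𝔸 i) (par : SiteParY 𝔸 i) {B₀ δ : ℝ} {U₁ : B.Cfg}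
  (ιB : BlkY i → IBondY i)

/-- ★★ **THE LEFT-BACKWARD CROSS ENTRY AT ONE CONFIGURATION**: from the (3.42) block of NODE 00's reading, unit norms of the bond variables and
`2(d+1) < M`: `η‖(∇*_{V,μ}O(V)(f ⊗ E))(z)‖ ≤ L·e^{2(d+1)|δ|}·B₀·ℓ(y)·e^{−δd(y,y′)}·|f|` for `‖E‖ ≤ 1`, `supp f ⊂ Δ(βy′)`, `z ∈ Δ(βy)` — print's second
entry `∇_U G′(U)` read at the neighbour site `z − e_μ` (block within `2(d+1)` of `Δ(βy)`, one level off at most).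
[cite: Balaban1985BackgroundPropagators, (3.42) p.397 (second member), (3.8) p.392, (3.5) p.391; Balaban1984PropagatorsII, (2.60) p.234, (2.54) p.233] -/
theorem eta_mul_norm_cdsS_O_le_of_eBlock (hE : EBlock (kernelFamilyS i B cfg O par) B₀ δ U₁) (hB₀ : 0 ≤ B₀)
    (hι : ∀ s, β i.hN i.D i.hk (ιB s) = s)
    {M₂ : ℝ} (hM₂ : 0 ≤ M₂) (hrepr : ∀ (v : 𝔸) (j : ι), |b.repr v j| ≤ M₂ * ‖v‖)
    (hU1 : ∀ (μ : Fin (d + 1)) (w : SiteY i), ‖((UboxY i (cfg U₁) μ w : 𝔸ˣ) : 𝔸)‖ ≤ 1 ∧ ‖(((UboxY i (cfg U₁) μ w)⁻¹ : 𝔸ˣ) : 𝔸)‖ ≤ 1)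
    (hdM : 2 * ((d : ℝ) + 1) < (geo9K i).M)
    (f : SiteY i → ℝ) (y y' : IBondY i) (hs : (geo9K i).suppIn (Sum.inl f) y') {E : 𝔸} (hE1 : ‖E‖ ≤ 1)
    {z : SiteY i} (μ : Fin (d + 1)) (hz : blkOf i.D.toDomains z = β i.hN i.D i.hk y) :
    etaS i * ‖cdsS i (cfg U₁) μ (O (cfg U₁) (liftY f E)) z‖ ≤
      ((ℓ + 1 : ℕ) : ℝ) * Real.exp (|δ| * (2 * ((d : ℝ) + 1))) *
        (B₀ * (geo9K i).len y * Real.exp (-(δ * (geo9K i).dist y y')) * (geo9K i).supNorm (Sum.inl f)) := by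
  set w : SiteY i := (shiftY i μ).symm z with hw
  have hzw : blkOf i.D.toDomains w = β i.hN i.D i.hk (blkC i ιB w) := by
    show blkOf i.D.toDomains w = β i.hN i.D i.hk (ιB (blkOf i.D.toDomains w)); rw [hι]
  have h1 := eta_mul_norm_cdS_le_of_eBlock i b cfg O par hE hM₂ hrepr f (blkC i ιB w) y' hs hE1 μ hzw
  have hy : β i.hN i.D i.hk (blkC i ιB z) = β i.hN i.D i.hk y := by
    show β i.hN i.D i.hk (ιB (blkOf i.D.toDomains z)) = _; rw [hι, hz]
  have hlen : (geo9K i).len (blkC i ιB w) ≤ ((ℓ + 1 : ℕ) : ℝ) * (geo9K i).len y := by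
    rw [← geo9K_len_congr i hy]; exact len_blkC_symm_shift_le i ιB hι hdM μ z
  have hst : (geo9K i).dist y (blkC i ιB w) ≤ 2 * ((d : ℝ) + 1) := by
    rw [← geo9K_dist_congr i hy rfl]; exact stencilB_blkC i ιB hι μ z
  have hdist : (geo9K i).dist y y' ≤ 2 * ((d : ℝ) + 1) + (geo9K i).dist (blkC i ιB w) y' := by
    linarith [geo9K_dist_triangle i y (blkC i ιB w) y']
  have hdist' : (geo9K i).dist (blkC i ιB w) y' ≤ 2 * ((d : ℝ) + 1) + (geo9K i).dist y y' := by
    rw [geo9K_dist_comm] at hst; linarith [geo9K_dist_triangle i (blkC i ιB w) y y']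
  have hexp := exp_neg_le_exp_mul_exp_neg (δ := δ) hdist hdist'
  have hsup : 0 ≤ (geo9K i).supNorm (Sum.inl f) := (abs_nonneg _).trans (abs_le_supNorm_inl i f z)
  have hleny : 0 ≤ (geo9K i).len y := (B6KLevelCensusIndexV1.len_pos i y).le
  calc etaS i * ‖cdsS i (cfg U₁) μ (O (cfg U₁) (liftY f E)) z‖
      ≤ etaS i * ‖cdS i (cfg U₁) μ (O (cfg U₁) (liftY f E)) w‖ :=
        mul_le_mul_of_nonneg_left (norm_cdsS_le_norm_cdS_symm_shift i (cfg U₁) hU1 μ _ z) (etaS_pos i).le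
    _ ≤ B₀ * (geo9K i).len (blkC i ιB w) * Real.exp (-(δ * (geo9K i).dist (blkC i ιB w) y')) * (geo9K i).supNorm (Sum.inl f) := h1
    _ ≤ B₀ * (((ℓ + 1 : ℕ) : ℝ) * (geo9K i).len y) * (Real.exp (|δ| * (2 * ((d : ℝ) + 1))) * Real.exp (-(δ * (geo9K i).dist y y'))) *
          (geo9K i).supNorm (Sum.inl f) := by
        gcongr
    _ = _ := by ring

/-! ## §4 ★★ The RIGHT-FORWARD cross entry: `η‖(O(V)∇_{V,μ}(f ⊗ E))(z)‖ ≤ m_N·M₂(Σ_j‖b_j‖)·e^{2(d+1)|δ|}·B₀ℓ(y)e^{−δd(y,y′)}|f|` -/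

/-- ★★ **THE RIGHT-FORWARD CROSS ENTRY AT ONE CONFIGURATION**: from the (3.42) block of NODE 00's reading, unit norms of the bond variables and a
bound `m_N` on the number of index bonds within `2(d+1)` of a bond: `η‖(O(V)∇_{V,μ}(f ⊗ E))(z)‖ ≤ m_N·M₂(Σ_j‖b_j‖)·e^{2(d+1)|δ|}·B₀·ℓ(y)·e^{−δd(y,y′)}·|f|` for
`‖E‖ ≤ 1`, `supp f ⊂ Δ(βy′)`, `z ∈ Δ(βy)` — `∇_μ = −∇*_μ∘T_μ`, the transported amplitude `T_μ(f ⊗ E) = Σ_j g_j ⊗ b_j` split into its block pieces over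
the neighbourhood of `y′`, and print's third entry `G′(U)∇*_U` applied to each piece.
[cite: Balaban1985BackgroundPropagators, (3.42) p.397 (third member), (3.3) p.390, (3.8) p.392; Balaban1984PropagatorsII, (2.51) p.232, (2.61) p.234, (2.54) p.233] -/
theorem eta_mul_norm_O_cdS_le_of_eBlock [Fintype (geo9K i).Site] (hE : EBlock (kernelFamilyS i B cfg O par) B₀ δ U₁) (hB₀ : 0 ≤ B₀)
    (hι : ∀ s, β i.hN i.D i.hk (ιB s) = s)
    {M₂ : ℝ} (hM₂ : 0 ≤ M₂) (hrepr : ∀ (v : 𝔸) (j : ι), |b.repr v j| ≤ M₂ * ‖v‖)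
    (hU1 : ∀ (μ : Fin (d + 1)) (w : SiteY i), ‖((UboxY i (cfg U₁) μ w : 𝔸ˣ) : 𝔸)‖ ≤ 1 ∧ ‖(((UboxY i (cfg U₁) μ w)⁻¹ : 𝔸ˣ) : 𝔸)‖ ≤ 1)
    {mN : ℕ} (hnbr : ∀ y' : IBondY i, (nbr (geo9K i) (2 * ((d : ℝ) + 1)) y').card ≤ mN)
    (f : SiteY i → ℝ) (y y' : IBondY i) (hs : (geo9K i).suppIn (Sum.inl f) y') {E : 𝔸} (hE1 : ‖E‖ ≤ 1)
    {z : SiteY i} (μ : Fin (d + 1)) (hz : blkOf i.D.toDomains z = β i.hN i.D i.hk y) :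
    etaS i * ‖O (cfg U₁) (cdS i (cfg U₁) μ (liftY f E)) z‖ ≤
      ((mN : ℝ) * (M₂ * ∑ j, ‖b j‖) * Real.exp (|δ| * (2 * ((d : ℝ) + 1)))) *
        (B₀ * (geo9K i).len y * Real.exp (-(δ * (geo9K i).dist y y')) * (geo9K i).supNorm (Sum.inl f)) := by
  classical
  have hη : 0 < etaS i := etaS_pos i
  have hsup : 0 ≤ (geo9K i).supNorm (Sum.inl f) := (abs_nonneg _).trans (abs_le_supNorm_inl i f z)
  have hleny : 0 ≤ (geo9K i).len y := (B6KLevelCensusIndexV1.len_pos i y).le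
  -- the neighbourhood of the input block and the pieces of the transported amplitude
  set T : Finset (IBondY i) := nbr (geo9K i) (2 * ((d : ℝ) + 1)) y' with hT
  set g : ι → SiteY i → ℝ := fun j w => f (shiftY i μ w) * b.repr (R (UboxY i (cfg U₁) μ w) E) j with hg
  set gp : ι → IBondY i → SiteY i → ℝ := fun j a w => if blkC i ιB w = a then g j w else 0 with hgp
  -- (i) where `g_j ≠ 0` the block is in the neighbourhood of `y′`
  have hmemT : ∀ j w, g j w ≠ 0 → blkC i ιB w ∈ T := by
    intro j w hw
    have hf : f (shiftY i μ w) ≠ 0 := fun h0 => hw (by simp only [hg, h0, zero_mul])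
    have hblk : blkOf i.D.toDomains (shiftY i μ w) = β i.hN i.D i.hk y' := hs _ hf
    have hc : β i.hN i.D i.hk (blkC i ιB (shiftY i μ w)) = β i.hN i.D i.hk y' := by
      show β i.hN i.D i.hk (ιB (blkOf i.D.toDomains (shiftY i μ w))) = _; rw [hι, hblk]
    refine mem_nbr.2 ?_
    rw [← geo9K_dist_congr i rfl hc]
    exact stencilF_blkC i ιB hι μ w
  -- (ii) `g_j` is the sum of its pieces over the neighbourhood
  have hsplit : ∀ j, g j = ∑ a ∈ T, gp j a := by
    intro j; funext w
    rw [Finset.sum_apply]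
    show g j w = ∑ a ∈ T, (if blkC i ιB w = a then g j w else 0)
    by_cases hw : g j w = 0
    · rw [hw]; symm
      exact Finset.sum_eq_zero fun a _ => ite_self 0
    · rw [Finset.sum_ite_eq, if_pos (hmemT j w hw)]
  -- (iii) the transported amplitude as a double sum of amplitudes
  have hΨ : (fun w => R (UboxY i (cfg U₁) μ w) (liftY f E (shiftY i μ w))) = ∑ j, ∑ a ∈ T, liftY (gp j a) (b j) := by
    rw [transport_liftY_eq_sum i b (cfg U₁) μ f E]
    refine Finset.sum_congr rfl fun j _ => ?_
    show liftY (g j) (b j) = _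
    rw [hsplit j, liftY_finset_sum]
  -- (iv) the operator identity `O(V)∇_μ(f ⊗ E) = −Σ_j Σ_a O(V)∇*_μ(g_{j,a} ⊗ b_j)`
  have hlin : ∀ {S : Type} (s : Finset S) (h : S → SiteY i → 𝔸),
      O (cfg U₁) (cdsS i (cfg U₁) μ (∑ a ∈ s, h a)) = ∑ a ∈ s, O (cfg U₁) (cdsS i (cfg U₁) μ (h a)) := by
    intro S s h
    have hms := map_sum ((O (cfg U₁)).restrictScalars ℝ ∘ₗ (cdsSL i (cfg U₁) μ).restrictScalars ℝ) h s
    simpa only [LinearMap.coe_comp, Function.comp_apply, LinearMap.coe_restrictScalars, cdsSL_apply] using hms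
  have hop : O (cfg U₁) (cdS i (cfg U₁) μ (liftY f E)) z = -(∑ j, ∑ a ∈ T, O (cfg U₁) (cdsS i (cfg U₁) μ (liftY (gp j a) (b j))) z) := by
    rw [cdS_eq_neg_cdsS_transport i (cfg U₁) μ, map_neg, hΨ, hlin, Pi.neg_apply, Finset.sum_apply]
    congr 1
    refine Finset.sum_congr rfl fun j _ => ?_
    rw [hlin, Finset.sum_apply]
  -- (v) each piece: print's third entry at the block `a`, the amplitude `b_j` rescaled into the ball
  have hpiece : ∀ j, ∀ a ∈ T, etaS i * ‖O (cfg U₁) (cdsS i (cfg U₁) μ (liftY (gp j a) (b j))) z‖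
      ≤ ‖b j‖ * (B₀ * (geo9K i).len y * Real.exp (-(δ * (geo9K i).dist y a)) * (M₂ * (geo9K i).supNorm (Sum.inl f))) := by
    intro j a _
    have hsa : (geo9K i).suppIn (Sum.inl (gp j a)) a := by
      intro w hw
      have hwa : blkC i ιB w = a := by
        by_contra hne
        exact hw (show (if blkC i ιB w = a then g j w else 0) = 0 by rw [if_neg hne])
      show blkOf i.D.toDomains w = β i.hN i.D i.hk a
      rw [← hwa]; show _ = β i.hN i.D i.hk (ιB (blkOf i.D.toDomains w)); rw [hι]
    have hgsup : (geo9K i).supNorm (Sum.inl (gp j a)) ≤ M₂ * (geo9K i).supNorm (Sum.inl f) := by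
      refine Real.iSup_le (fun w => ?_) (mul_nonneg hM₂ hsup)
      show |(if blkC i ιB w = a then g j w else 0)| ≤ _
      by_cases hwa : blkC i ιB w = a
      · rw [if_pos hwa]
        show |f (shiftY i μ w) * b.repr (R (UboxY i (cfg U₁) μ w) E) j| ≤ _
        rw [abs_mul]
        have hR : ‖R (UboxY i (cfg U₁) μ w) E‖ ≤ 1 := (norm_R_le (hU1 μ w).1 (hU1 μ w).2 E).trans hE1
        calc |f (shiftY i μ w)| * |b.repr (R (UboxY i (cfg U₁) μ w) E) j|
            ≤ (geo9K i).supNorm (Sum.inl f) * (M₂ * ‖R (UboxY i (cfg U₁) μ w) E‖) :=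
              mul_le_mul (abs_le_supNorm_inl i f _) (hrepr _ _) (abs_nonneg _) hsup
          _ ≤ (geo9K i).supNorm (Sum.inl f) * (M₂ * 1) := by gcongr
          _ = M₂ * (geo9K i).supNorm (Sum.inl f) := by ring
      · rw [if_neg hwa, abs_zero]; exact mul_nonneg hM₂ hsup
    have hF : ∀ (c : ℂ) (E' : 𝔸), O (cfg U₁) (cdsS i (cfg U₁) μ (liftY (gp j a) (c • E'))) z =
        c • O (cfg U₁) (cdsS i (cfg U₁) μ (liftY (gp j a) E')) z := by
      intro c E'; rw [liftY_smul_right, cdsS_smul, map_smul, Pi.smul_apply]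
    have hX0 : 0 ≤ B₀ * (geo9K i).len y * Real.exp (-(δ * (geo9K i).dist y a)) := by positivity
    have hball : ∀ E' : 𝔸, ‖E'‖ ≤ 1 → ‖O (cfg U₁) (cdsS i (cfg U₁) μ (liftY (gp j a) E')) z‖ ≤
        (etaS i)⁻¹ * (B₀ * (geo9K i).len y * Real.exp (-(δ * (geo9K i).dist y a)) * (M₂ * (geo9K i).supNorm (Sum.inl f))) := by
      intro E' hE'
      have h2 := eta_mul_norm_cdsS_le_of_eBlock i b cfg O par hE hM₂ hrepr (gp j a) y a hsa hE' μ hz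
      rw [le_inv_mul_iff₀ hη]
      exact h2.trans (mul_le_mul_of_nonneg_left hgsup hX0)
    have h3 := norm_le_norm_mul_of_ball (fun E' => O (cfg U₁) (cdsS i (cfg U₁) μ (liftY (gp j a) E')) z) hF hball (b j)
    calc etaS i * ‖O (cfg U₁) (cdsS i (cfg U₁) μ (liftY (gp j a) (b j))) z‖
        ≤ etaS i * (‖b j‖ * ((etaS i)⁻¹ * (B₀ * (geo9K i).len y * Real.exp (-(δ * (geo9K i).dist y a)) *
            (M₂ * (geo9K i).supNorm (Sum.inl f))))) := mul_le_mul_of_nonneg_left h3 hη.le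
      _ = _ := by field_simp
  -- (vi) the decay at a neighbourhood block versus the decay at `y′`
  have hexpa : ∀ a ∈ T, Real.exp (-(δ * (geo9K i).dist y a)) ≤
      Real.exp (|δ| * (2 * ((d : ℝ) + 1))) * Real.exp (-(δ * (geo9K i).dist y y')) := by
    intro a ha
    have ha' : (geo9K i).dist a y' ≤ 2 * ((d : ℝ) + 1) := mem_nbr.1 ha
    have ha'' : (geo9K i).dist y' a ≤ 2 * ((d : ℝ) + 1) := by rwa [geo9K_dist_comm]
    exact exp_neg_le_exp_mul_exp_neg (δ := δ) (by linarith [geo9K_dist_triangle i y a y']) (by linarith [geo9K_dist_triangle i y y' a])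
  -- (vii) assemble
  have hsum : etaS i * ‖O (cfg U₁) (cdS i (cfg U₁) μ (liftY f E)) z‖ ≤
      ∑ j, ∑ a ∈ T, etaS i * ‖O (cfg U₁) (cdsS i (cfg U₁) μ (liftY (gp j a) (b j))) z‖ := by
    rw [hop, norm_neg]
    calc etaS i * ‖∑ j, ∑ a ∈ T, O (cfg U₁) (cdsS i (cfg U₁) μ (liftY (gp j a) (b j))) z‖
        ≤ etaS i * ∑ j, ‖∑ a ∈ T, O (cfg U₁) (cdsS i (cfg U₁) μ (liftY (gp j a) (b j))) z‖ :=
          mul_le_mul_of_nonneg_left (norm_sum_le _ _) hη.le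
      _ ≤ etaS i * ∑ j, ∑ a ∈ T, ‖O (cfg U₁) (cdsS i (cfg U₁) μ (liftY (gp j a) (b j))) z‖ :=
          mul_le_mul_of_nonneg_left (Finset.sum_le_sum fun j _ => norm_sum_le _ _) hη.le
      _ = _ := by rw [Finset.mul_sum]; exact Finset.sum_congr rfl fun j _ => Finset.mul_sum _ _ _
  have hK0 : 0 ≤ B₀ * (geo9K i).len y := mul_nonneg hB₀ hleny
  calc etaS i * ‖O (cfg U₁) (cdS i (cfg U₁) μ (liftY f E)) z‖
      ≤ ∑ j, ∑ a ∈ T, etaS i * ‖O (cfg U₁) (cdsS i (cfg U₁) μ (liftY (gp j a) (b j))) z‖ := hsum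
    _ ≤ ∑ j, ∑ a ∈ T, ‖b j‖ * (B₀ * (geo9K i).len y * (Real.exp (|δ| * (2 * ((d : ℝ) + 1))) * Real.exp (-(δ * (geo9K i).dist y y'))) *
          (M₂ * (geo9K i).supNorm (Sum.inl f))) :=
        Finset.sum_le_sum fun j _ => Finset.sum_le_sum fun a ha => (hpiece j a ha).trans (by gcongr; exact hexpa a ha)
    _ = ∑ j, (T.card : ℝ) * (‖b j‖ * (B₀ * (geo9K i).len y * (Real.exp (|δ| * (2 * ((d : ℝ) + 1))) * Real.exp (-(δ * (geo9K i).dist y y'))) *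
          (M₂ * (geo9K i).supNorm (Sum.inl f)))) := by
        simp only [Finset.sum_const, nsmul_eq_mul]
    _ ≤ ∑ j, (mN : ℝ) * (‖b j‖ * (B₀ * (geo9K i).len y * (Real.exp (|δ| * (2 * ((d : ℝ) + 1))) * Real.exp (-(δ * (geo9K i).dist y y'))) *
          (M₂ * (geo9K i).supNorm (Sum.inl f)))) :=
        Finset.sum_le_sum fun j _ => mul_le_mul_of_nonneg_right (Nat.cast_le.2 (hnbr y')) (by positivity)
    _ = _ := by rw [← Finset.mul_sum, ← Finset.sum_mul]; ring

end Cross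

/-! ## §5 ★ The two cross letter composites and their (2.51) block majorants -/

section Letters

variable (O : SiteOpY 𝔸 i) (V : CfgY 𝔸 i)

omit [Fintype ι] in
/-- `(−η⁻¹∇*_μ-letter) * G = −η·∇*_{V,μ}∘O(V)` for `G = η²O(V)`: the LEFT-BACKWARD cross composite (the frame's letter `k = inr μ` on the left).
[cite: Balaban1985BackgroundPropagators, (3.8) p.392, (3.42) p.397 (not an entry of print)] -/
theorem neg_gradB_mul_apply (G : Module.End ℝ (SiteY i → 𝔸)) (hG : ∀ Λ, G Λ = (etaS i ^ 2) • O V Λ) (μ : Fin (d + 1)) (Λ : SiteY i → 𝔸) (w : SiteY i) :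
    (-gradLetterB (shiftY i) (UboxY i V) ((((etaS i : ℝ) : ℂ))⁻¹) μ * G) Λ w = -(((etaS i : ℝ) : ℂ) • cdsS i V μ (O V Λ) w) := by
  have hη : ((etaS i : ℝ) : ℂ) ≠ 0 := by exact_mod_cast (etaS_pos i).ne'
  rw [Module.End.mul_apply, LinearMap.neg_apply, Pi.neg_apply, gradLetterB_apply, hG, ← Complex.coe_smul, covDstar_smul, smul_smul]
  show -(((((etaS i : ℝ) : ℂ))⁻¹ * (((etaS i ^ 2 : ℝ)) : ℂ)) • cdsS i V μ (O V Λ) w) = _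
  congr 2
  push_cast
  rw [pow_two, inv_mul_cancel_left₀ hη]

omit [Fintype ι] in
/-- `G * (η⁻¹∇_μ-letter) = η·O(V)∘∇_{V,μ}` for `G = η²O(V)`: the RIGHT-FORWARD cross composite (the frame's letter `k = inl μ` on the right).
[cite: Balaban1985BackgroundPropagators, (3.3) p.390, (3.42) p.397 (not an entry of print)] -/
theorem mul_gradF_apply (G : Module.End ℝ (SiteY i → 𝔸)) (hG : ∀ Λ, G Λ = (etaS i ^ 2) • O V Λ) (μ : Fin (d + 1)) (Λ : SiteY i → 𝔸) (w : SiteY i) :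
    (G * gradLetterF (shiftY i) (UboxY i V) ((((etaS i : ℝ) : ℂ))⁻¹) μ) Λ w = ((etaS i : ℝ) : ℂ) • O V (cdS i V μ Λ) w := by
  have hη : ((etaS i : ℝ) : ℂ) ≠ 0 := by exact_mod_cast (etaS_pos i).ne'
  have hF : gradLetterF (shiftY i) (UboxY i V) ((((etaS i : ℝ) : ℂ))⁻¹) μ Λ = ((((etaS i : ℝ) : ℂ))⁻¹) • cdS i V μ Λ := by
    funext x; rw [gradLetterF_apply, Pi.smul_apply]; rfl
  rw [Module.End.mul_apply, hG, hF, map_smul, Pi.smul_apply, Pi.smul_apply, ← Complex.coe_smul, smul_smul]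
  congr 1
  push_cast
  rw [pow_two, mul_inv_cancel_right₀ hη]

end Letters

section Majorants

variable {B : B9.Backgrounds} (cfg : B.Cfg → CfgY 𝔸 i) (O : SiteOpY 𝔸 i) (par : SiteParY 𝔸 i) {B₀ δ : ℝ} {U₁ : B.Cfg}
variable [Fintype (geo9K i).Site] {Rr : ℝ} {Hp : Prop}

/-- ★★ **READ, left-backward cross ⇒ the majorant of `conj b (−η⁻¹∇*_μ-letter) * conj b (η²O(V))`** (backward letter `k = inr μ` on the LEFT) with constant
`L·e^{2(d+1)|δ|}·M₂(Σ_j‖b_j‖)·B₀`, profile `ℓ(a)`, SAME rate `δ`. [cite: Balaban1985BackgroundPropagators, (3.42) p.397, (3.8) p.392; Balaban1984PropagatorsII, (2.51)–(2.52) p.232, (2.60) p.234] -/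
theorem hasMajorant_gradB_mul_G_of_eBlock (hE : EBlock (kernelFamilyS i B cfg O par) B₀ δ U₁) (hB₀ : 0 ≤ B₀)
    (ιB : BlkY i → IBondY i) (hι : ∀ s, β i.hN i.D i.hk (ιB s) = s)
    {M₂ : ℝ} (hM₂ : 0 ≤ M₂) (hrepr : ∀ (v : 𝔸) (j : ι), |b.repr v j| ≤ M₂ * ‖v‖) {η : ℝ} (hη : η = etaS i)
    {Uc : Fin (d + 1) → SiteY i → 𝔸ˣ} (hUc : Uc = UboxY i (cfg U₁))
    (hU1 : ∀ (μ : Fin (d + 1)) (w : SiteY i), ‖((Uc μ w : 𝔸ˣ) : 𝔸)‖ ≤ 1 ∧ ‖(((Uc μ w)⁻¹ : 𝔸ˣ) : 𝔸)‖ ≤ 1)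
    (hdM : 2 * ((d : ℝ) + 1) < (geo9K i).M)
    (G : Module.End ℝ (SiteY i → 𝔸)) (hG : ∀ Λ, G Λ = (η ^ 2) • O (cfg U₁) Λ) (μ : Fin (d + 1)) :
    HasMajorant (g := toB6 (geo9K i) Rr Hp) (fun p : SiteY i × ι => ιB (blkOf i.D.toDomains p.1))
      (conj b (diffLetter (shiftY i) Uc (((η : ℂ))⁻¹) (Sum.inr μ)) * conj b G)
      (fun a a' => (((ℓ + 1 : ℕ) : ℝ) * Real.exp (|δ| * (2 * ((d : ℝ) + 1)))) * (M₂ * (∑ j, ‖b j‖) * B₀) *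
        (geo9K i).len a * Real.exp (-(δ * (geo9K i).dist a a'))) := by
  subst hη hUc
  rw [← B9Eq352DivFormLetters.conj_mul, diffLetter_inr]
  have hη0 : 0 ≤ etaS i := (etaS_pos i).le
  have hTc : ∀ (c : ℂ) (Λ : SiteY i → 𝔸), (-gradLetterB (shiftY i) (UboxY i (cfg U₁)) ((((etaS i : ℝ) : ℂ))⁻¹) μ * G) (c • Λ) =
      c • (-gradLetterB (shiftY i) (UboxY i (cfg U₁)) ((((etaS i : ℝ) : ℂ))⁻¹) μ * G) Λ := by
    intro c Λ; funext w
    rw [neg_gradB_mul_apply i O (cfg U₁) G hG, Pi.smul_apply, neg_gradB_mul_apply i O (cfg U₁) G hG, map_smul, cdsS_smul, Pi.smul_apply,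
      smul_neg]
    congr 1
    exact smul_comm _ _ _
  have hC0 : 0 ≤ ((ℓ + 1 : ℕ) : ℝ) * Real.exp (|δ| * (2 * ((d : ℝ) + 1))) := by positivity
  have h := hasMajorant_conj_of_ball_bound i b (Rr := Rr) (Hp := Hp) _ hTc ιB hι hM₂ hrepr
    (fun a a' => ((ℓ + 1 : ℕ) : ℝ) * Real.exp (|δ| * (2 * ((d : ℝ) + 1))) * (B₀ * (geo9K i).len a * Real.exp (-(δ * (geo9K i).dist a a'))))
    (fun a a' => mul_nonneg hC0 (mul_nonneg (mul_nonneg hB₀ (B6KLevelCensusIndexV1.len_pos i a).le) (Real.exp_pos _).le)) ?_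
  · exact hasMajorant_mono _ h fun a a' => le_of_eq (by ring)
  · intro f y y' hs E hE1 z hz
    rw [neg_gradB_mul_apply i O (cfg U₁) G hG, norm_neg, norm_smul, Complex.norm_real, Real.norm_eq_abs, abs_of_nonneg hη0]
    exact (eta_mul_norm_cdsS_O_le_of_eBlock i b cfg O par ιB hE hB₀ hι hM₂ hrepr hU1 hdM f y y' hs hE1 μ hz).trans (le_of_eq (by ring))

/-- ★★ **READ, right-forward cross ⇒ the majorant of `conj b (η²O(V)) * conj b (η⁻¹∇_μ-letter)`** (forward letter `k = inl μ` on the RIGHT) with constant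
`m_N·M₂(Σ_j‖b_j‖)·e^{2(d+1)|δ|}·M₂(Σ_j‖b_j‖)·B₀`, profile `ℓ(a)`, SAME rate `δ`. [cite: Balaban1985BackgroundPropagators, (3.42) p.397, (3.3) p.390; Balaban1984PropagatorsII, (2.51)–(2.52) p.232, (2.61) p.234] -/
theorem hasMajorant_G_mul_gradF_of_eBlock (hE : EBlock (kernelFamilyS i B cfg O par) B₀ δ U₁) (hB₀ : 0 ≤ B₀)
    (ιB : BlkY i → IBondY i) (hι : ∀ s, β i.hN i.D i.hk (ιB s) = s)
    {M₂ : ℝ} (hM₂ : 0 ≤ M₂) (hrepr : ∀ (v : 𝔸) (j : ι), |b.repr v j| ≤ M₂ * ‖v‖) {η : ℝ} (hη : η = etaS i)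
    {Uc : Fin (d + 1) → SiteY i → 𝔸ˣ} (hUc : Uc = UboxY i (cfg U₁))
    (hU1 : ∀ (μ : Fin (d + 1)) (w : SiteY i), ‖((Uc μ w : 𝔸ˣ) : 𝔸)‖ ≤ 1 ∧ ‖(((Uc μ w)⁻¹ : 𝔸ˣ) : 𝔸)‖ ≤ 1)
    {mN : ℕ} (hnbr : ∀ y' : IBondY i, (nbr (geo9K i) (2 * ((d : ℝ) + 1)) y').card ≤ mN)
    (G : Module.End ℝ (SiteY i → 𝔸)) (hG : ∀ Λ, G Λ = (η ^ 2) • O (cfg U₁) Λ) (μ : Fin (d + 1)) :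
    HasMajorant (g := toB6 (geo9K i) Rr Hp) (fun p : SiteY i × ι => ιB (blkOf i.D.toDomains p.1))
      (conj b G * conj b (diffLetter (shiftY i) Uc (((η : ℂ))⁻¹) (Sum.inl μ)))
      (fun a a' => ((mN : ℝ) * (M₂ * ∑ j, ‖b j‖) * Real.exp (|δ| * (2 * ((d : ℝ) + 1)))) * (M₂ * (∑ j, ‖b j‖) * B₀) *
        (geo9K i).len a * Real.exp (-(δ * (geo9K i).dist a a'))) := by
  subst hη hUc
  rw [← B9Eq352DivFormLetters.conj_mul, diffLetter_inl]
  have hη0 : 0 ≤ etaS i := (etaS_pos i).le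
  have hTc : ∀ (c : ℂ) (Λ : SiteY i → 𝔸), (G * gradLetterF (shiftY i) (UboxY i (cfg U₁)) ((((etaS i : ℝ) : ℂ))⁻¹) μ) (c • Λ) =
      c • (G * gradLetterF (shiftY i) (UboxY i (cfg U₁)) ((((etaS i : ℝ) : ℂ))⁻¹) μ) Λ := by
    intro c Λ; funext w
    rw [mul_gradF_apply i O (cfg U₁) G hG, Pi.smul_apply, mul_gradF_apply i O (cfg U₁) G hG, cdS_smul, map_smul, Pi.smul_apply]
    exact smul_comm _ _ _
  have hC0 : 0 ≤ (mN : ℝ) * (M₂ * ∑ j, ‖b j‖) * Real.exp (|δ| * (2 * ((d : ℝ) + 1))) := by positivity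
  have h := hasMajorant_conj_of_ball_bound i b (Rr := Rr) (Hp := Hp) _ hTc ιB hι hM₂ hrepr
    (fun a a' => ((mN : ℝ) * (M₂ * ∑ j, ‖b j‖) * Real.exp (|δ| * (2 * ((d : ℝ) + 1)))) *
      (B₀ * (geo9K i).len a * Real.exp (-(δ * (geo9K i).dist a a'))))
    (fun a a' => mul_nonneg hC0 (mul_nonneg (mul_nonneg hB₀ (B6KLevelCensusIndexV1.len_pos i a).le) (Real.exp_pos _).le)) ?_
  · exact hasMajorant_mono _ h fun a a' => le_of_eq (by ring)
  · intro f y y' hs E hE1 z hz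
    rw [mul_gradF_apply i O (cfg U₁) G hG, norm_smul, Complex.norm_real, Real.norm_eq_abs, abs_of_nonneg hη0]
    exact (eta_mul_norm_O_cdS_le_of_eBlock i b cfg O par ιB hE hB₀ hι hM₂ hrepr hU1 hnbr f y y' hs hE1 μ hz).trans (le_of_eq (by ring))

end Majorants

end Literature.MathematicalPhysics.QuantumFieldTheory.Balaban1983to89.Node00.OpsYRead342Cross
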